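import Literature.Analysis.FluidPDE.PassiveVectorGalerkinTail
import Literature.Analysis.FluidPDE.PassiveScalarEnergyProofs
import HarnessLib

/-!
# Energy equality for weak passive solenoidal vectors (`A = 0`) with bounded carrier

Analysis/FluidPDE file (everything proved; no definitions, no named facts). For `ν > 0`, a carrier
`b` with `stLift b ∈ L^∞((0,T) × T^d)` (weakly divergence free for a.e. `t` — part of the class) and
an `L²` weakly divergence-free datum `w₀`, EVERY weak solution `w ∈ L^∞_t L²_x` of the passive
solenoidal vector equation `∂ₜw + (b·∇)w + ∇π = νΔw`, `∇·w = 0` on `T^d × [0,T)`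
(`Torus.IsWeakPassiveVectorOn 0 T ν b w₀ w`, Yoshida–Kaneda 2000, (4)–(5) with `(α,β) = (0,1)`)
satisfies the **energy equality** for a.e. `t ∈ (0,T)`:

  `‖w(t)‖²_{L²} + 2ν ∫₀ᵗ ‖∇w‖²_{L²} = ‖w₀‖²_{L²}`

(`IsWeakPassiveVectorOn.ae_energy_eq`, in `[0,∞]` with `Torus.eVectorDissipation`), hence the LOWER
energy inequality `‖w₀‖² ≤ ‖w(t)‖² + 2ν∫₀ᵗ‖∇w‖²` (`…ae_lower_energy_ineq`) asked for by route
`SolenoidalFractalHomogenisation` (support item `CascadeBookkeeping`, stub V2 `stub_lowerEnergy`; cell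
`ad-ideate`, LIT-PACK §38/§40b). This is the linear (Lions–Magenes / Temam) energy equality for
parabolic equations with bounded first-order coefficients, obtained here by the Galerkin form of the
Lions–Shinbrot argument run on the weak solution: the truncated identity
`‖P_N w(t)‖² = ‖P_N w₀‖² + 2∫₀ᵗ Φ[w; P_N w]` (`PassiveVectorGalerkinIdentity`), the flux rewritten as
`∫⟪w - P_N w, (b·∇)P_N w⟫ - ν‖∇P_N w‖²`, the `L²_t H¹_x` regularity of the class
(`PassiveVectorDissipationBound`, finite dissipation), Cauchy–Schwarz in space and time for the
transport remainder (`≤ d M (∫₀ᵀ‖w - P_N w‖²)^{1/2} (∫₀ᵀ‖∇w‖²)^{1/2} → 0` by dominated convergence of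
the Parseval tails), monotone convergence of the truncated dissipation and Parseval for the energies.

## Mathlib / tree search

Tree: `PassiveVectorGalerkinIdentity`, `PassiveVectorDissipationBound` (`eVectorDissipation_lt_top`),
`DuchonRobertLionsEnergyEquality` (`tendsto_integral_inner_fourierTruncate_self`, measurability of
truncations), `StatisticalSolutionEnergyEq` (`eGradNormSq_fourierTruncate_le/_eq_sum`), `NSHopfLimit`
(`Torus.aemeasurable_eGradNormSq_of_coeff`), `TorusTrigPoly` (`tendsto_lintegral_enorm_sq_fourierTruncate_sub`,
Bessel), `PassiveVectorGalerkinTail` (tails, truncated dissipation), `PassiveScalarEnergyProofs`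
(`ae_ae_norm_le_of_memLp_top_stLift`). Scalar twin:
`PassiveScalarDiagEnergyEquality.energy_eq`.

## References

* R. Temam, *Navier–Stokes Equations*, 3rd ed. (1984), Ch. III §1, Lemma 1.2 and (1.30)–(1.33)
  (energy equality of linear parabolic problems, `u ∈ L²(V)`, `u' ∈ L²(V')`). [`Temam1984`]
* J. C. Robinson, J. L. Rodrigo, W. Sadowski, *The three-dimensional Navier–Stokes equations*
  (CUP 2016), §4.2 (4.20), Lemma 4.1. [`RobinsonRodrigoSadowski2016`]
* K. Yoshida, Y. Kaneda, Phys. Rev. E 63 (2000) 016308, §II eq. (4)–(5). [`YoshidaKaneda2000`]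
-/

noncomputable section

open MeasureTheory Set Filter Function TopologicalSpace
open scoped ENNReal NNReal InnerProductSpace Topology

namespace Literature.Analysis.FluidPDE

namespace Torus

variable {d : Type*} [Fintype d] [DecidableEq d]

/-! ## Two real-analysis helpers -/

omit [Fintype d] [DecidableEq d] in
/-- **Cauchy–Schwarz for square roots**: `∫ √f √g ≤ √(∫ f) √(∫ g)` for nonnegative integrable `f, g`
(copy of the private lemma of `PassiveScalarDiagEnergy`). [folklore] -/
private theorem integral_sqrt_mul_sqrt_le {α : Type*} [MeasurableSpace α] {μ : Measure α} {f g : α → ℝ}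
    (hf : Integrable f μ) (hg : Integrable g μ) (hf0 : 0 ≤ᵐ[μ] f) (hg0 : 0 ≤ᵐ[μ] g) :
    ∫ x, Real.sqrt (f x) * Real.sqrt (g x) ∂μ ≤ Real.sqrt (∫ x, f x ∂μ) * Real.sqrt (∫ x, g x ∂μ) := by
  have hmem : ∀ {φ : α → ℝ}, Integrable φ μ → 0 ≤ᵐ[μ] φ →
      MemLp (fun x => Real.sqrt (φ x)) (ENNReal.ofReal 2) μ := by
    intro φ hφ hφ0
    rw [show ENNReal.ofReal 2 = 2 by simp]
    refine (memLp_two_iff_integrable_sq (Real.continuous_sqrt.comp_aestronglyMeasurable hφ.1)).2 ?_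
    refine hφ.congr ?_
    filter_upwards [hφ0] with x hx
    rw [Real.sq_sqrt hx]
  have h := integral_mul_le_Lp_mul_Lq_of_nonneg Real.HolderConjugate.two_two
    (ae_of_all _ fun x => Real.sqrt_nonneg (f x)) (ae_of_all _ fun x => Real.sqrt_nonneg (g x)) (hmem hf hf0) (hmem hg hg0)
  have e1 : ∫ x, Real.sqrt (f x) ^ (2 : ℝ) ∂μ = ∫ x, f x ∂μ := by
    refine integral_congr_ae ?_
    filter_upwards [hf0] with x hx
    rw [Real.rpow_two, Real.sq_sqrt hx]
  have e2 : ∫ x, Real.sqrt (g x) ^ (2 : ℝ) ∂μ = ∫ x, g x ∂μ := by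
    refine integral_congr_ae ?_
    filter_upwards [hg0] with x hx
    rw [Real.rpow_two, Real.sq_sqrt hx]
  rw [e1, e2] at h
  simpa [Real.sqrt_eq_rpow] using h

omit [Fintype d] [DecidableEq d] in
/-- Squeeze: if `|xₙ| ≤ yₙ` and `yₙ → 0` then `xₙ → 0`. [folklore] -/
private theorem tendsto_zero_of_abs_le {x y : ℕ → ℝ} (hxy : ∀ n, |x n| ≤ y n) (hy : Tendsto y atTop (𝓝 0)) :
    Tendsto x atTop (𝓝 0) :=
  squeeze_zero_norm (fun n => by simpa [Real.norm_eq_abs] using hxy n) hy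

namespace IsWeakPassiveVectorOn

variable {A T ν : ℝ} {b w : ℝ → UnitAddTorus d → EuclideanSpace ℝ d} {w₀ : UnitAddTorus d → EuclideanSpace ℝ d}

/-! ## The energy equality -/

/-- **Energy equality for weak passive solenoidal vectors with bounded carrier (`A = 0`), core
form.** If `ν > 0`, `‖b‖ ≤ M` a.e., `w₀ ∈ L²` is weakly divergence free and the dissipation
`∫⁻₀ᵀ ‖∇w‖₂²` is finite, then for a.e. `t ∈ (0,T)`,
`∫‖w(t)‖² + 2ν (∫⁻_{(0,t)} ‖∇w‖₂²).toReal = ∫‖w₀‖²` (Temam 1984, Ch. III, Lemma 1.2 / (1.33); Galerkin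
form of the Lions–Shinbrot argument). [cite: Temam1984, Ch. III §1 Lemma 1.2] -/
theorem ae_energy_eq_of_lintegral_lt_top (h : IsWeakPassiveVectorOn 0 T ν b w₀ w)
    (hw₀ : MemLp w₀ 2 volume) (hdiv₀ : FunctionSpaces.Torus.IsWeaklyDivFree w₀) {M : ℝ} (hM : 0 ≤ M)
    (hbM : ∀ᵐ s ∂(volume.restrict (Ioo 0 T)), ∀ᵐ x ∂volume, ‖b s x‖ ≤ M)
    (hfin : ∫⁻ s in Ioo 0 T, FunctionSpaces.Torus.eGradNormSq (w s) < ⊤) :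
    ∀ᵐ t ∂(volume.restrict (Ioo 0 T)),
      (∫ x, ‖w t x‖ ^ 2) + 2 * ν * (∫⁻ s in Ioo 0 t, FunctionSpaces.Torus.eGradNormSq (w s)).toReal = ∫ x, ‖w₀ x‖ ^ 2 := by
  classical
  -- ### notation
  set P : ℕ → (UnitAddTorus d → EuclideanSpace ℝ d) → UnitAddTorus d → EuclideanSpace ℝ d :=
    fun N v => FunctionSpaces.Torus.fourierTruncate N v with hP
  set F : ℕ → ℝ → ℝ := fun N s =>
    (∫ x, ⟪w s x, FunctionSpaces.Torus.convect (b s) (P N (w s)) x + ν • FunctionSpaces.Torus.laplacian (P N (w s)) x⟫_ℝ) +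
      (0 : ℝ) * ∫ x, ⟪b s x, FunctionSpaces.Torus.convect (w s) (P N (w s)) x⟫_ℝ with hF
  set D : ℕ → ℝ → ℝ := fun N s => (FunctionSpaces.Torus.eGradNormSq (P N (w s))).toReal with hD
  set R : ℕ → ℝ → ℝ := fun N s =>
    ∫ x, ⟪w s x - P N (w s) x, FunctionSpaces.Torus.convect (b s) (P N (w s)) x⟫_ℝ with hR
  set tail : ℕ → ℝ → ℝ := fun N s => ∫ x, ‖w s x - P N (w s) x‖ ^ 2 with htail
  set C : ℝ := Fintype.card d * M with hC
  have hC0 : 0 ≤ C := by positivity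
  set g : ℝ → ℝ≥0∞ := fun s => FunctionSpaces.Torus.eGradNormSq (w s) with hg
  -- ### the truncated identity for a.e. `t` and all `N`
  have hId : ∀ᵐ t ∂(volume.restrict (Ioo 0 T)), ∀ N,
      ∫ x, ⟪P N (w t) x, P N (w t) x⟫_ℝ = (∫ x, ⟪P N w₀ x, P N w₀ x⟫_ℝ) + 2 * ∫ s in Ioc 0 t, F N s :=
    ae_all_iff.2 fun N => h.ae_galerkin_energy_eq hw₀ hdiv₀ N
  -- ### integrability on `(0,T)`
  have hFint : ∀ N, IntegrableOn (F N) (Ioo 0 T) := fun N => h.integrableOn_galerkinFlux N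
  have hDint : ∀ N, IntegrableOn (D N) (Ioo 0 T) ∧ ∫ s in Ioo 0 T, D N s ≤ (∫⁻ s in Ioo 0 T, g s).toReal :=
    fun N => h.integrableOn_toReal_eGradNormSq_fourierTruncate hfin N
  obtain ⟨htailint, -, -⟩ := h.galerkin_tail
  -- ### the flux rewritten, a.e. in `s`
  have hFR : ∀ N, ∀ᵐ s ∂(volume.restrict (Ioo 0 T)),
      F N s = R N s - ν * D N s ∧ |R N s| ≤ C * Real.sqrt (tail N s) * Real.sqrt (D N s) :=
    fun N => h.ae_galerkinFlux_eq_remainder hM hbM N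
  -- ### second pass: the remainder integral is small, uniformly in `t`
  have htail_nn : ∀ N s, 0 ≤ tail N s := fun N s => integral_nonneg fun x => sq_nonneg _
  have hD_nn : ∀ N s, 0 ≤ D N s := fun N s => ENNReal.toReal_nonneg
  set Y : ℕ → ℝ := fun N =>
    C * (Real.sqrt (∫ s in Ioo 0 T, tail N s) * Real.sqrt ((∫⁻ s in Ioo 0 T, g s).toReal)) with hYdef
  have hY : ∀ N, ∫ s in Ioo 0 T, |F N s + ν * D N s| ≤ Y N := by
    intro N
    have hm : AEStronglyMeasurable (fun s => Real.sqrt (tail N s) * Real.sqrt (D N s)) (volume.restrict (Ioo 0 T)) :=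
      (Real.continuous_sqrt.comp_aestronglyMeasurable (htailint N).aestronglyMeasurable).mul
        (Real.continuous_sqrt.comp_aestronglyMeasurable (hDint N).1.aestronglyMeasurable)
    have hst : IntegrableOn (fun s => Real.sqrt (tail N s) * Real.sqrt (D N s)) (Ioo 0 T) := by
      refine Integrable.mono' (((htailint N).add (hDint N).1).div_const 2) hm (ae_of_all _ fun s => ?_)
      show ‖Real.sqrt (tail N s) * Real.sqrt (D N s)‖ ≤ (tail N s + D N s) / 2
      rw [Real.norm_eq_abs, abs_of_nonneg (mul_nonneg (Real.sqrt_nonneg _) (Real.sqrt_nonneg _))]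
      nlinarith [Real.sq_sqrt (htail_nn N s), Real.sq_sqrt (hD_nn N s),
        sq_nonneg (Real.sqrt (tail N s) - Real.sqrt (D N s))]
    calc ∫ s in Ioo 0 T, |F N s + ν * D N s|
        ≤ ∫ s in Ioo 0 T, C * (Real.sqrt (tail N s) * Real.sqrt (D N s)) := by
          refine integral_mono_ae (((hFint N).add ((hDint N).1.const_mul ν)).abs) (hst.const_mul C) ?_
          filter_upwards [hFR N] with s hs
          rw [hs.1, sub_add_cancel]
          calc |R N s| ≤ C * Real.sqrt (tail N s) * Real.sqrt (D N s) := hs.2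
            _ = C * (Real.sqrt (tail N s) * Real.sqrt (D N s)) := by ring
      _ = C * ∫ s in Ioo 0 T, Real.sqrt (tail N s) * Real.sqrt (D N s) := integral_const_mul _ _
      _ ≤ C * (Real.sqrt (∫ s in Ioo 0 T, tail N s) * Real.sqrt (∫ s in Ioo 0 T, D N s)) :=
          mul_le_mul_of_nonneg_left (integral_sqrt_mul_sqrt_le (htailint N) (hDint N).1
            (ae_of_all _ fun s => htail_nn N s) (ae_of_all _ fun s => hD_nn N s)) hC0
      _ ≤ Y N := by
          rw [hYdef]
          exact mul_le_mul_of_nonneg_left (mul_le_mul_of_nonneg_left (Real.sqrt_le_sqrt (hDint N).2)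
            (Real.sqrt_nonneg _)) hC0
  have hY0 : Tendsto Y atTop (𝓝 0) := by
    have h1 := h.tendsto_integral_galerkin_tail
    have h2 : Tendsto (fun N => Real.sqrt (∫ s in Ioo 0 T, tail N s)) atTop (𝓝 0) := by
      have := (Real.continuous_sqrt.tendsto 0).comp h1
      rwa [Real.sqrt_zero] at this
    have h3 := (h2.mul_const (Real.sqrt ((∫⁻ s in Ioo 0 T, g s).toReal))).const_mul C
    rw [zero_mul, mul_zero] at h3
    exact h3
  -- ### conclude at a.e. `t`
  filter_upwards [hId, h.ae_memLp_two, ae_restrict_mem measurableSet_Ioo] with t ht ht2 htI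
  have hsub : Ioc 0 t ⊆ Ioo 0 T := Ioc_subset_Ioo_right htI.2
  have hFt : ∀ N, IntegrableOn (F N) (Ioc 0 t) := fun N => (hFint N).mono_set hsub
  have hDt : ∀ N, IntegrableOn (D N) (Ioc 0 t) := fun N => (hDint N).1.mono_set hsub
  -- the identity in the form `E_N(t) + 2ν ∫ D_N = E_N(0) + 2 X_N(t)`
  have hX : ∀ N, (∫ x, ⟪P N (w t) x, P N (w t) x⟫_ℝ) + 2 * ν * ∫ s in Ioc 0 t, D N s =
      (∫ x, ⟪P N w₀ x, P N w₀ x⟫_ℝ) + 2 * ∫ s in Ioc 0 t, (F N s + ν * D N s) := by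
    intro N
    rw [ht N, integral_add (hFt N) ((hDt N).const_mul ν), integral_const_mul]
    ring
  have hXle : ∀ N, |∫ s in Ioc 0 t, (F N s + ν * D N s)| ≤ Y N := by
    intro N
    calc |∫ s in Ioc 0 t, (F N s + ν * D N s)| ≤ ∫ s in Ioc 0 t, |F N s + ν * D N s| := abs_integral_le_integral_abs
      _ ≤ ∫ s in Ioo 0 T, |F N s + ν * D N s| :=
          setIntegral_mono_set (((hFint N).add ((hDint N).1.const_mul ν)).abs)
            (ae_of_all _ fun s => abs_nonneg _) hsub.eventuallyLE
      _ ≤ Y N := hY N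
  have hX0 : Tendsto (fun N => ∫ s in Ioc 0 t, (F N s + ν * D N s)) atTop (𝓝 0) :=
    tendsto_zero_of_abs_le hXle hY0
  -- energies
  have hE : Tendsto (fun N => ∫ x, ⟪P N (w t) x, P N (w t) x⟫_ℝ) atTop (𝓝 (∫ x, ‖w t x‖ ^ 2)) :=
    tendsto_integral_inner_fourierTruncate_self ht2
  have hE0 : Tendsto (fun N => ∫ x, ⟪P N w₀ x, P N w₀ x⟫_ℝ) atTop (𝓝 (∫ x, ‖w₀ x‖ ^ 2)) :=
    tendsto_integral_inner_fourierTruncate_self hw₀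
  -- the truncated dissipation on `(0,t]`: monotone convergence
  have hDlim : Tendsto (fun N => ∫ s in Ioc 0 t, D N s) atTop (𝓝 ((∫⁻ s in Ioo 0 t, g s).toReal)) := by
    set μt : Measure ℝ := volume.restrict (Ioo 0 t) with hμt
    have hsub' : Ioo 0 t ⊆ Ioo 0 T := Ioo_subset_Ioo le_rfl htI.2.le
    have hle : μt ≤ volume.restrict (Ioo 0 T) := Measure.restrict_mono hsub' le_rfl
    have hG_m : ∀ N, AEMeasurable (fun s => FunctionSpaces.Torus.eGradNormSq (P N (w s))) μt := fun N =>
      (h.aemeasurable_eGradNormSq_fourierTruncate N).mono_measure hle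
    have hfin_t : ∫⁻ s in Ioo 0 t, g s ≠ ⊤ := ((lintegral_mono' hle le_rfl).trans_lt hfin).ne
    have hgood : ∀ᵐ s ∂μt, Integrable (w s) volume :=
      ae_restrict_of_ae_restrict_of_subset hsub' (h.ae_integrable_slice.mono fun s hs => hs.1)
    have hL : Tendsto (fun N => ∫⁻ s in Ioo 0 t, FunctionSpaces.Torus.eGradNormSq (P N (w s))) atTop
        (𝓝 (∫⁻ s in Ioo 0 t, g s)) := by
      refine lintegral_tendsto_of_tendsto_of_monotone hG_m ?_ ?_
      · filter_upwards [hgood] with s hs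
        intro N N' hNN'
        show FunctionSpaces.Torus.eGradNormSq (P N (w s)) ≤ FunctionSpaces.Torus.eGradNormSq (P N' (w s))
        rw [hP, Torus.eGradNormSq_fourierTruncate_eq_sum hs N, Torus.eGradNormSq_fourierTruncate_eq_sum hs N']
        exact mul_le_mul' le_rfl (Finset.sum_le_sum_of_subset (FunctionSpaces.Torus.freqBall_mono hNN'))
      · filter_upwards [hgood] with s hs
        have hsum := (ENNReal.summable (f := fun k : d → ℤ =>
          ENNReal.ofReal (FunctionSpaces.Torus.freqNormSq k) *
            ‖UnitAddTorus.mFourierCoeff (FunctionSpaces.EuclideanSpace.complexify ∘ w s) k‖ₑ ^ 2)).hasSum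
        have h' := ENNReal.Tendsto.const_mul (hsum.comp FunctionSpaces.Torus.tendsto_freqBall_atTop)
          (Or.inr (ENNReal.ofReal_ne_top (r := 4 * Real.pi ^ 2)))
        rw [← FunctionSpaces.Torus.eGradNormSq_eq_tsum] at h'
        exact h'.congr fun N => (Torus.eGradNormSq_fourierTruncate_eq_sum hs N).symm
    have hL' := (ENNReal.tendsto_toReal hfin_t).comp hL
    refine hL'.congr fun N => ?_
    have hfinN : ∀ᵐ s ∂μt, FunctionSpaces.Torus.eGradNormSq (P N (w s)) < ⊤ := ae_of_all _ fun s =>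
      FunctionSpaces.Torus.eGradNormSq_lt_top (FunctionSpaces.Torus.isSmooth_fourierTruncate N _)
    rw [Function.comp_apply, ← integral_toReal (hG_m N) hfinN, hμt, setIntegral_congr_set Ioo_ae_eq_Ioc]
  -- pass to the limit
  have hlim1 : Tendsto (fun N => (∫ x, ⟪P N (w t) x, P N (w t) x⟫_ℝ) + 2 * ν * ∫ s in Ioc 0 t, D N s) atTop
      (𝓝 ((∫ x, ‖w t x‖ ^ 2) + 2 * ν * (∫⁻ s in Ioo 0 t, g s).toReal)) := hE.add (hDlim.const_mul (2 * ν))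
  have hlim2 : Tendsto (fun N => (∫ x, ⟪P N w₀ x, P N w₀ x⟫_ℝ) + 2 * ∫ s in Ioc 0 t, (F N s + ν * D N s)) atTop
      (𝓝 ((∫ x, ‖w₀ x‖ ^ 2) + 2 * 0)) := hE0.add (hX0.const_mul 2)
  rw [mul_zero, add_zero] at hlim2
  exact tendsto_nhds_unique (hlim1.congr fun N => hX N) hlim2

/-- **Energy equality for weak passive solenoidal vectors (`A = 0`) with bounded carrier.** For
`ν > 0`, `stLift b ∈ L^∞((0,T) × T^d)` and an `L²` weakly divergence-free datum `w₀`, every weak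
solution satisfies, for a.e. `t ∈ (0,T)`, `‖w(t)‖²_{L²} + 2ν∫₀ᵗ‖∇w‖²_{L²} = ‖w₀‖²_{L²}` (in `[0,∞]`,
with `Torus.eVectorDissipation`; Temam 1984, Ch. III §1, Lemma 1.2; the finite dissipation comes from
`PassiveVectorDissipationBound.eVectorDissipation_lt_top`). [cite: Temam1984, Ch. III §1 Lemma 1.2] -/
theorem ae_energy_eq (h : IsWeakPassiveVectorOn 0 T ν b w₀ w) (hν : 0 < ν)
    (hw₀ : MemLp w₀ 2 volume) (hdiv₀ : FunctionSpaces.Torus.IsWeaklyDivFree w₀)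
    (hb : MemLp (FunctionSpaces.Torus.stLift b) ∞ (volume.restrict (Ioo 0 T ×ˢ univ))) :
    ∀ᵐ t ∂(volume.restrict (Ioo 0 T)),
      ENNReal.ofReal (∫ x, ‖w t x‖ ^ 2) + 2 * eVectorDissipation ν w 0 t = ENNReal.ofReal (∫ x, ‖w₀ x‖ ^ 2) := by
  obtain ⟨M, hM, hbM⟩ := ae_ae_norm_le_of_memLp_top_stLift hb
  have hDT : eVectorDissipation ν w 0 T < ⊤ := h.eVectorDissipation_lt_top hν hw₀ hdiv₀ hb
  have hfin : ∫⁻ s in Ioo 0 T, FunctionSpaces.Torus.eGradNormSq (w s) < ⊤ := by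
    unfold eVectorDissipation at hDT
    rcases ENNReal.mul_lt_top_iff.1 hDT with h1 | h1 | h1
    · exact h1.2
    · exact absurd (ENNReal.ofReal_eq_zero.1 h1) (not_le.2 hν)
    · rw [h1]; exact ENNReal.zero_lt_top
  filter_upwards [h.ae_energy_eq_of_lintegral_lt_top hw₀ hdiv₀ hM hbM hfin, ae_restrict_mem measurableSet_Ioo]
    with t ht htI
  have hfin_t : ∫⁻ s in Ioo 0 t, FunctionSpaces.Torus.eGradNormSq (w s) ≠ ⊤ :=
    ((lintegral_mono' (Measure.restrict_mono (Ioo_subset_Ioo le_rfl htI.2.le) le_rfl) le_rfl).trans_lt hfin).ne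
  unfold eVectorDissipation
  rw [← ht, ENNReal.ofReal_add (integral_nonneg fun x => sq_nonneg _) (by positivity), mul_assoc,
    ENNReal.ofReal_mul (by norm_num : (0:ℝ) ≤ 2), ENNReal.ofReal_ofNat, ENNReal.ofReal_mul hν.le,
    ENNReal.ofReal_toReal hfin_t]

/-- **Lower energy inequality** (the V2 input of route `SolenoidalFractalHomogenisation`'s support item
`CascadeBookkeeping`): under the same hypotheses, for a.e. `t ∈ (0,T)`,
`‖w₀‖² ≤ ‖w(t)‖² + 2ν∫₀ᵗ‖∇w‖²` in `[0,∞]`. [cite: Temam1984, Ch. III §1 Lemma 1.2] -/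
theorem ae_lower_energy_ineq (h : IsWeakPassiveVectorOn 0 T ν b w₀ w) (hν : 0 < ν)
    (hw₀ : MemLp w₀ 2 volume) (hdiv₀ : FunctionSpaces.Torus.IsWeaklyDivFree w₀)
    (hb : MemLp (FunctionSpaces.Torus.stLift b) ∞ (volume.restrict (Ioo 0 T ×ˢ univ))) :
    ∀ᵐ t ∂(volume.restrict (Ioo 0 T)),
      ENNReal.ofReal (vectorL2Sq w₀) ≤ ENNReal.ofReal (vectorL2Sq (w t)) + 2 * eVectorDissipation ν w 0 t := by
  filter_upwards [h.ae_energy_eq hν hw₀ hdiv₀ hb] with t ht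
  exact le_of_eq ht.symm


end IsWeakPassiveVectorOn

end Torus

end Literature.Analysis.FluidPDE

end
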